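import Summits.ValiantsHypothesis.ValiantsHypothesis.Theorems.SymPencilPerFourPeeledTwoPencilClassify
import Summits.ValiantsHypothesis.ValiantsHypothesis.Theorems.SymPencilPerFourPeeledTwoPencilCaseAParams
import Summits.ValiantsHypothesis.ValiantsHypothesis.Theorems.SymPencilPerFourPeeledTwoPencilZeroColumns
import Summits.ValiantsHypothesis.ValiantsHypothesis.Theorems.SymPencilPerFourPeeledTwoPencilSigmaZeroFrames
import Summits.ValiantsHypothesis.ValiantsHypothesis.Theorems.SymPencilPerFourPeeledTwoPencilCoreClasses
import Summits.ValiantsHypothesis.ValiantsHypothesis.Theorems.SymPencilPerFourPeeledTwoPencilColumnKill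
import Summits.ValiantsHypothesis.ValiantsHypothesis.Theorems.SymPencilPerFourPeeledTwoPencilSwapRankOne
import Summits.ValiantsHypothesis.ValiantsHypothesis.Theorems.SymPencilPerFourPeeledTwoPencilSingleEntries
import Summits.ValiantsHypothesis.ValiantsHypothesis.Theorems.SymPencilPerFourPeeledTwoPencilCoverageTools

/-!
# Route `SymPencil` — inner rank of the `2 | 2` row split of `per_4`, PEELED case: the COVERAGE
# THEOREM of the (8,8,11) two-pencil programme — a frameless correction matrix is a generalised
# swap (`--supports` stmt-ValiantsHypothesis-5674 `SdcSuperquadratic`; (8,8) column, cell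
# (8,8,11); memo `NOTE-p8g15-5674-R2-two-pencil.md` §9; rung currency only)

**Theorem** (`genSwap_of_frameless`).  Let `Ψ ∈ K^{4×4}` (`char K = 0`) be such that NEITHER `Ψ`
NOR `Ψᵀ` admits a two-pencil frame (the matrix-level frame body of
`…TwoPencilFrameless.false_of_peeled_of_frame_at`).  Then `Ψ` is a GENERALISED SWAP: for some
`i ≠ j` and `u, w ≠ 0`, `a ⬝ Ψ x = u·a_i x_j + w·a_j x_i` for all `a, x` (this includes the pure
swap `u = w`, which is frameless indeed — `…/Negative/TwoPencilHFramesFalse`, crit-5 g4).  This is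
the hypothesis `hcov` of p6 g17's conditional assembly `…PeeledElevenOfCoverage`; the corner
theorems (`…CornerGenSwapFrameless.false_of_frameless_genswap_pair`) dispose of the output.

PROOF = the decision tree of memo §9.7 over p6 g17's classifier `…TwoPencilClassify.classify`,
every branch a NAMED chart lemma pulled back along a coordinate permutation
(`…TwoPencilClassify.frames_of_submatrix`) and, where needed, through the transpose:
* Case A ⇒ `…TwoPencilCaseAParams.hframes_of_caseA_class` (p6 g16);
* R3 (double swap) ⇒ `…TwoPencilSigmaZeroFrames.frames_of_double_swap`;
* R2 (zero column, swap pair, third column `c`): `(c₀,c₁) ≠ 0 ≠ (c₂,c₃)` or `c₀ = c₁ = 0 ≠ c₂c₃`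
  ⇒ Case A for the TRANSPOSE (`…TwoPencilCoverageTools.caseA_of_witness`); `c₂ = c₃ = 0` ⇒
  `…TwoPencilSwapRankOne.frames_of_swap_plus_rank_one`; `c₀ = c₁ = 0`, one of `c₂, c₃` zero ⇒
  `…TwoPencilCoreClasses.frames_of_swap_plus_diag / _offdiag` (p8 g15);
* R1 (two zero columns): a third zero column ⇒ `…TwoPencilZeroColumns.frames_of_three_zero_columns`;
  a non-zero column with two non-zero entries ⇒ `…TwoPencilColumnKill.frames_of_two_zero_columns_kill`;
  both non-zero columns single entries in ONE row ⇒ three zero columns for the transpose; in two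
  rows ⇒ `…TwoPencilSingleEntries.frames_of_single_entries` unless the pattern is the generalised
  swap — the OUTPUT (`…TwoPencilCoverageTools.form_of_single_entries`, `…dotProduct_mulVec_submatrix`).

Honest framing: the coverage half of cell (8,8,11); composed with p6 g17's corner and assembly
files it yields HR2(11)/IR11/the cell — those compositions live THERE, not here; the window
`28 ≤ sdc(per₄) ≤ 29` of record until that assembly is accepted, the crux `SdcSuperquadratic`
(super-quadratic growth in `n`) and `VP ≠ VNP` are untouched.  No definitions, no named facts.
[folklore]
-/

noncomputable section

-- single-conjunct layout: Sub = Summit, duplicated namespace component intended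
set_option linter.dupNamespace false

namespace Summit.ValiantsHypothesis.ValiantsHypothesis.Theorems.SymPencilPerFourPeeledTwoPencilCoverage

open Matrix Finset Module
open Summit.ValiantsHypothesis.ValiantsHypothesis.Theorems.SymPencilPerFourPeeledTwoPencilClassify
open Summit.ValiantsHypothesis.ValiantsHypothesis.Theorems.SymPencilPerFourPeeledTwoPencilCaseAParams
open Summit.ValiantsHypothesis.ValiantsHypothesis.Theorems.SymPencilPerFourPeeledTwoPencilZeroColumns
open Summit.ValiantsHypothesis.ValiantsHypothesis.Theorems.SymPencilPerFourPeeledTwoPencilSigmaZeroFrames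
open Summit.ValiantsHypothesis.ValiantsHypothesis.Theorems.SymPencilPerFourPeeledTwoPencilCoreClasses
open Summit.ValiantsHypothesis.ValiantsHypothesis.Theorems.SymPencilPerFourPeeledTwoPencilColumnKill
open Summit.ValiantsHypothesis.ValiantsHypothesis.Theorems.SymPencilPerFourPeeledTwoPencilSwapRankOne
open Summit.ValiantsHypothesis.ValiantsHypothesis.Theorems.SymPencilPerFourPeeledTwoPencilSingleEntries
open Summit.ValiantsHypothesis.ValiantsHypothesis.Theorems.SymPencilPerFourPeeledTwoPencilCoverageTools

universe u

variable {K : Type u} [Field K]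

/-- Framelessness descends to simultaneous coordinate permutations (contrapositive of
`frames_of_submatrix`). [folklore] -/
theorem not_frames_submatrix (σ : Equiv.Perm (Fin 4)) (Ψ : Matrix (Fin 4) (Fin 4) K)
    (h : ¬
      ∃ (a₀ a₁ y₀ y₁ : Fin 4 → K) (P₀₀ P₁₀ P₀₁ P₁₁ W₀ : Matrix (Fin 4) (Fin 4) K)
        (v : Fin 4 → Fin 4 → K) (s : Fin 4 → K) (W : Matrix (Fin 4) (Fin 4) K),
        a₀ ⬝ᵥ Ψ *ᵥ y₀ = 0 ∧ a₀ ⬝ᵥ Ψ *ᵥ y₁ = 0 ∧ a₁ ⬝ᵥ Ψ *ᵥ y₀ = 0 ∧ a₁ ⬝ᵥ Ψ *ᵥ y₁ = 0 ∧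
        (∀ b l, P₀₀ b l = (Matrix.of ![a₀, Pi.single b 1, y₀, Pi.single l 1]).permanent) ∧
        (∀ b l, P₁₀ b l = (Matrix.of ![a₀, Pi.single b 1, y₁, Pi.single l 1]).permanent) ∧
        (∀ b l, P₀₁ b l = (Matrix.of ![a₁, Pi.single b 1, y₀, Pi.single l 1]).permanent) ∧
        (∀ b l, P₁₁ b l = (Matrix.of ![a₁, Pi.single b 1, y₁, Pi.single l 1]).permanent) ∧
        W₀ * P₀₀ = 1 ∧ (∀ j, P₁₀ *ᵥ v j = s j • P₀₀ *ᵥ v j) ∧ (∀ i j, i ≠ j → s i ≠ s j) ∧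
        W * Matrix.of v = 1 ∧ P₁₁ - P₁₀ * W₀ * P₀₁ ≠ 0) :
    ¬
      ∃ (a₀ a₁ y₀ y₁ : Fin 4 → K) (P₀₀ P₁₀ P₀₁ P₁₁ W₀ : Matrix (Fin 4) (Fin 4) K)
        (v : Fin 4 → Fin 4 → K) (s : Fin 4 → K) (W : Matrix (Fin 4) (Fin 4) K),
        a₀ ⬝ᵥ Ψ.submatrix σ σ *ᵥ y₀ = 0 ∧ a₀ ⬝ᵥ Ψ.submatrix σ σ *ᵥ y₁ = 0 ∧ a₁ ⬝ᵥ Ψ.submatrix σ σ *ᵥ y₀ = 0 ∧ a₁ ⬝ᵥ Ψ.submatrix σ σ *ᵥ y₁ = 0 ∧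
        (∀ b l, P₀₀ b l = (Matrix.of ![a₀, Pi.single b 1, y₀, Pi.single l 1]).permanent) ∧
        (∀ b l, P₁₀ b l = (Matrix.of ![a₀, Pi.single b 1, y₁, Pi.single l 1]).permanent) ∧
        (∀ b l, P₀₁ b l = (Matrix.of ![a₁, Pi.single b 1, y₀, Pi.single l 1]).permanent) ∧
        (∀ b l, P₁₁ b l = (Matrix.of ![a₁, Pi.single b 1, y₁, Pi.single l 1]).permanent) ∧
        W₀ * P₀₀ = 1 ∧ (∀ j, P₁₀ *ᵥ v j = s j • P₀₀ *ᵥ v j) ∧ (∀ i j, i ≠ j → s i ≠ s j) ∧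
        W * Matrix.of v = 1 ∧ P₁₁ - P₁₀ * W₀ * P₀₁ ≠ 0 :=
  fun hs => h (frames_of_submatrix σ Ψ hs)

/-- Framelessness of the transpose descends to simultaneous coordinate permutations. [folklore] -/
theorem not_frames_transpose_submatrix (σ : Equiv.Perm (Fin 4)) (Ψ : Matrix (Fin 4) (Fin 4) K)
    (h : ¬
      ∃ (a₀ a₁ y₀ y₁ : Fin 4 → K) (P₀₀ P₁₀ P₀₁ P₁₁ W₀ : Matrix (Fin 4) (Fin 4) K)
        (v : Fin 4 → Fin 4 → K) (s : Fin 4 → K) (W : Matrix (Fin 4) (Fin 4) K),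
        a₀ ⬝ᵥ Ψᵀ *ᵥ y₀ = 0 ∧ a₀ ⬝ᵥ Ψᵀ *ᵥ y₁ = 0 ∧ a₁ ⬝ᵥ Ψᵀ *ᵥ y₀ = 0 ∧ a₁ ⬝ᵥ Ψᵀ *ᵥ y₁ = 0 ∧
        (∀ b l, P₀₀ b l = (Matrix.of ![a₀, Pi.single b 1, y₀, Pi.single l 1]).permanent) ∧
        (∀ b l, P₁₀ b l = (Matrix.of ![a₀, Pi.single b 1, y₁, Pi.single l 1]).permanent) ∧
        (∀ b l, P₀₁ b l = (Matrix.of ![a₁, Pi.single b 1, y₀, Pi.single l 1]).permanent) ∧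
        (∀ b l, P₁₁ b l = (Matrix.of ![a₁, Pi.single b 1, y₁, Pi.single l 1]).permanent) ∧
        W₀ * P₀₀ = 1 ∧ (∀ j, P₁₀ *ᵥ v j = s j • P₀₀ *ᵥ v j) ∧ (∀ i j, i ≠ j → s i ≠ s j) ∧
        W * Matrix.of v = 1 ∧ P₁₁ - P₁₀ * W₀ * P₀₁ ≠ 0) :
    ¬
      ∃ (a₀ a₁ y₀ y₁ : Fin 4 → K) (P₀₀ P₁₀ P₀₁ P₁₁ W₀ : Matrix (Fin 4) (Fin 4) K)
        (v : Fin 4 → Fin 4 → K) (s : Fin 4 → K) (W : Matrix (Fin 4) (Fin 4) K),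
        a₀ ⬝ᵥ (Ψ.submatrix σ σ)ᵀ *ᵥ y₀ = 0 ∧ a₀ ⬝ᵥ (Ψ.submatrix σ σ)ᵀ *ᵥ y₁ = 0 ∧ a₁ ⬝ᵥ (Ψ.submatrix σ σ)ᵀ *ᵥ y₀ = 0 ∧ a₁ ⬝ᵥ (Ψ.submatrix σ σ)ᵀ *ᵥ y₁ = 0 ∧
        (∀ b l, P₀₀ b l = (Matrix.of ![a₀, Pi.single b 1, y₀, Pi.single l 1]).permanent) ∧
        (∀ b l, P₁₀ b l = (Matrix.of ![a₀, Pi.single b 1, y₁, Pi.single l 1]).permanent) ∧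
        (∀ b l, P₀₁ b l = (Matrix.of ![a₁, Pi.single b 1, y₀, Pi.single l 1]).permanent) ∧
        (∀ b l, P₁₁ b l = (Matrix.of ![a₁, Pi.single b 1, y₁, Pi.single l 1]).permanent) ∧
        W₀ * P₀₀ = 1 ∧ (∀ j, P₁₀ *ᵥ v j = s j • P₀₀ *ᵥ v j) ∧ (∀ i j, i ≠ j → s i ≠ s j) ∧
        W * Matrix.of v = 1 ∧ P₁₁ - P₁₀ * W₀ * P₀₁ ≠ 0 := by
  rw [Matrix.transpose_submatrix]
  exact fun hs => h (frames_of_submatrix σ Ψᵀ hs)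

/-- ★★ **COVERAGE: a frameless correction matrix (with frameless transpose) is a generalised swap.**
See the module docstring. [folklore] -/
theorem genSwap_of_frameless [CharZero K] (Ψ : Matrix (Fin 4) (Fin 4) K)
    (h₁ : ¬
      ∃ (a₀ a₁ y₀ y₁ : Fin 4 → K) (P₀₀ P₁₀ P₀₁ P₁₁ W₀ : Matrix (Fin 4) (Fin 4) K)
        (v : Fin 4 → Fin 4 → K) (s : Fin 4 → K) (W : Matrix (Fin 4) (Fin 4) K),
        a₀ ⬝ᵥ Ψ *ᵥ y₀ = 0 ∧ a₀ ⬝ᵥ Ψ *ᵥ y₁ = 0 ∧ a₁ ⬝ᵥ Ψ *ᵥ y₀ = 0 ∧ a₁ ⬝ᵥ Ψ *ᵥ y₁ = 0 ∧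
        (∀ b l, P₀₀ b l = (Matrix.of ![a₀, Pi.single b 1, y₀, Pi.single l 1]).permanent) ∧
        (∀ b l, P₁₀ b l = (Matrix.of ![a₀, Pi.single b 1, y₁, Pi.single l 1]).permanent) ∧
        (∀ b l, P₀₁ b l = (Matrix.of ![a₁, Pi.single b 1, y₀, Pi.single l 1]).permanent) ∧
        (∀ b l, P₁₁ b l = (Matrix.of ![a₁, Pi.single b 1, y₁, Pi.single l 1]).permanent) ∧
        W₀ * P₀₀ = 1 ∧ (∀ j, P₁₀ *ᵥ v j = s j • P₀₀ *ᵥ v j) ∧ (∀ i j, i ≠ j → s i ≠ s j) ∧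
        W * Matrix.of v = 1 ∧ P₁₁ - P₁₀ * W₀ * P₀₁ ≠ 0)
    (h₂ : ¬
      ∃ (a₀ a₁ y₀ y₁ : Fin 4 → K) (P₀₀ P₁₀ P₀₁ P₁₁ W₀ : Matrix (Fin 4) (Fin 4) K)
        (v : Fin 4 → Fin 4 → K) (s : Fin 4 → K) (W : Matrix (Fin 4) (Fin 4) K),
        a₀ ⬝ᵥ Ψᵀ *ᵥ y₀ = 0 ∧ a₀ ⬝ᵥ Ψᵀ *ᵥ y₁ = 0 ∧ a₁ ⬝ᵥ Ψᵀ *ᵥ y₀ = 0 ∧ a₁ ⬝ᵥ Ψᵀ *ᵥ y₁ = 0 ∧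
        (∀ b l, P₀₀ b l = (Matrix.of ![a₀, Pi.single b 1, y₀, Pi.single l 1]).permanent) ∧
        (∀ b l, P₁₀ b l = (Matrix.of ![a₀, Pi.single b 1, y₁, Pi.single l 1]).permanent) ∧
        (∀ b l, P₀₁ b l = (Matrix.of ![a₁, Pi.single b 1, y₀, Pi.single l 1]).permanent) ∧
        (∀ b l, P₁₁ b l = (Matrix.of ![a₁, Pi.single b 1, y₁, Pi.single l 1]).permanent) ∧
        W₀ * P₀₀ = 1 ∧ (∀ j, P₁₀ *ᵥ v j = s j • P₀₀ *ᵥ v j) ∧ (∀ i j, i ≠ j → s i ≠ s j) ∧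
        W * Matrix.of v = 1 ∧ P₁₁ - P₁₀ * W₀ * P₀₁ ≠ 0) :
    ∃ (i j : Fin 4) (u w : K), i ≠ j ∧ u ≠ 0 ∧ w ≠ 0 ∧
      ∀ a x : Fin 4 → K, a ⬝ᵥ Ψ *ᵥ x = u * a i * x j + w * a j * x i := by
  classical
  rcases classify Ψ with ⟨σ, hc, hns⟩ | ⟨σ, hR1⟩ | ⟨σ, h3, h2, h10, hc0, hc1, hsym⟩ |
      ⟨σ, la, mu, hla, hmu, hlit⟩
  · -- Case A
    exact absurd (hframes_of_caseA_class Ψ σ hc hns) h₁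
  · -- R1: the columns `σ2, σ3` vanish
    have n₁ := not_frames_submatrix σ Ψ h₁
    have n₂ := not_frames_transpose_submatrix σ Ψ h₂
    obtain ⟨Φ, hΦ⟩ : ∃ Φ : Matrix (Fin 4) (Fin 4) K, Φ = Ψ.submatrix σ σ := ⟨_, rfl⟩
    rw [← hΦ] at n₁ n₂
    have eΦ : ∀ i j, Φ i j = Ψ (σ i) (σ j) := fun i j => by rw [hΦ]; rfl
    have f2 : ∀ i, Φ i 2 = 0 := fun i => by rw [eΦ]; exact (hR1 (σ i)).1
    have f3 : ∀ i, Φ i 3 = 0 := fun i => by rw [eΦ]; exact (hR1 (σ i)).2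
    by_cases z0 : ∀ i, Φ i 0 = 0
    · -- three zero columns `0, 2, 3`: move column `1` to position `3`
      refine absurd (frames_of_submatrix (Equiv.swap (1 : Fin 4) 3) Φ
        (frames_of_three_zero_columns _ ?_)) n₁
      intro k l hl
      have four : ∀ j : Fin 4, j = 0 ∨ j = 1 ∨ j = 2 ∨ j = 3 := by decide
      have s0 : (Equiv.swap (1 : Fin 4) 3) 0 = 0 := by decide
      have s1 : (Equiv.swap (1 : Fin 4) 3) 1 = 3 := by decide
      have s2 : (Equiv.swap (1 : Fin 4) 3) 2 = 2 := by decide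
      rcases four l with rfl | rfl | rfl | rfl
      · rw [Matrix.submatrix_apply, s0]; exact z0 _
      · rw [Matrix.submatrix_apply, s1]; exact f3 _
      · rw [Matrix.submatrix_apply, s2]; exact f2 _
      · exact absurd rfl hl
    by_cases z1 : ∀ i, Φ i 1 = 0
    · -- three zero columns `1, 2, 3`: move column `0` to position `3`
      refine absurd (frames_of_submatrix (Equiv.swap (0 : Fin 4) 3) Φ
        (frames_of_three_zero_columns _ ?_)) n₁
      intro k l hl
      have four : ∀ j : Fin 4, j = 0 ∨ j = 1 ∨ j = 2 ∨ j = 3 := by decide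
      have s0 : (Equiv.swap (0 : Fin 4) 3) 0 = 3 := by decide
      have s1 : (Equiv.swap (0 : Fin 4) 3) 1 = 1 := by decide
      have s2 : (Equiv.swap (0 : Fin 4) 3) 2 = 2 := by decide
      rcases four l with rfl | rfl | rfl | rfl
      · rw [Matrix.submatrix_apply, s0]; exact f3 _
      · rw [Matrix.submatrix_apply, s1]; exact z1 _
      · rw [Matrix.submatrix_apply, s2]; exact f2 _
      · exact absurd rfl hl
    push Not at z0 z1
    obtain ⟨p, hp⟩ := z0
    obtain ⟨p', hp'⟩ := z1
    by_cases m1 : ∃ q, q ≠ p' ∧ Φ q 1 ≠ 0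
    · -- column `1` has two non-zero entries: kill it (relabel `(1,2,3,0) ↦ (0,1,2,3)`)
      obtain ⟨q, hqp, hq⟩ := m1
      have r0 : (finRotate 4) 0 = 1 := by decide
      have r1 : (finRotate 4) 1 = 2 := by decide
      have r2 : (finRotate 4) 2 = 3 := by decide
      refine absurd (frames_of_submatrix (finRotate 4) Φ
        (frames_of_two_zero_columns_kill _ ?_ ?_ ((finRotate 4).symm p') ((finRotate 4).symm q)
          ?_ ?_ ?_)) n₁
      · intro i; rw [Matrix.submatrix_apply, r1]; exact f2 _
      · intro i; rw [Matrix.submatrix_apply, r2]; exact f3 _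
      · exact fun h => hqp ((finRotate 4).symm.injective h).symm
      · rw [Matrix.submatrix_apply, r0, Equiv.apply_symm_apply]; exact hp'
      · rw [Matrix.submatrix_apply, r0, Equiv.apply_symm_apply]; exact hq
    by_cases m0 : ∃ q, q ≠ p ∧ Φ q 0 ≠ 0
    · -- column `0` has two non-zero entries: kill it (relabel `(0,2,3,1) ↦ (0,1,2,3)`)
      obtain ⟨q, hqp, hq⟩ := m0
      have r0 : (Equiv.swap (1 : Fin 4) 2 * Equiv.swap (2 : Fin 4) 3) 0 = 0 := by decide
      have r1 : (Equiv.swap (1 : Fin 4) 2 * Equiv.swap (2 : Fin 4) 3) 1 = 2 := by decide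
      have r2 : (Equiv.swap (1 : Fin 4) 2 * Equiv.swap (2 : Fin 4) 3) 2 = 3 := by decide
      refine absurd (frames_of_submatrix (Equiv.swap (1 : Fin 4) 2 * Equiv.swap (2 : Fin 4) 3) Φ
        (frames_of_two_zero_columns_kill _ ?_ ?_
          ((Equiv.swap (1 : Fin 4) 2 * Equiv.swap (2 : Fin 4) 3).symm p)
          ((Equiv.swap (1 : Fin 4) 2 * Equiv.swap (2 : Fin 4) 3).symm q) ?_ ?_ ?_)) n₁
      · intro i; rw [Matrix.submatrix_apply, r1]; exact f2 _
      · intro i; rw [Matrix.submatrix_apply, r2]; exact f3 _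
      · exact fun h => hqp ((Equiv.swap (1 : Fin 4) 2 * Equiv.swap (2 : Fin 4) 3).symm.injective h).symm
      · rw [Matrix.submatrix_apply, r0, Equiv.apply_symm_apply]; exact hp
      · rw [Matrix.submatrix_apply, r0, Equiv.apply_symm_apply]; exact hq
    push Not at m0 m1
    -- both non-zero columns are single entries: rows `p` (column 0) and `p'` (column 1)
    have m0' : ∀ q, q ≠ p → Φ q 0 = 0 := fun q hq => by
      by_contra h; exact h (m0 q hq) |>.elim
    have m1' : ∀ q, q ≠ p' → Φ q 1 = 0 := fun q hq => by
      by_contra h; exact h (m1 q hq) |>.elim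
    have hf := form_of_single_entries Φ p p' f2 f3 m0' m1'
    by_cases hpp : p = p'
    · -- one non-zero row `p`: the transpose has three zero columns (move `p` to `3`)
      subst hpp
      refine absurd (frames_of_submatrix (Equiv.swap p 3) Φᵀ
        (frames_of_three_zero_columns _ ?_)) n₂
      intro k l hl
      have hlp : (Equiv.swap p 3) l ≠ p := by
        rw [Ne, Equiv.swap_apply_eq_iff, Equiv.swap_apply_left]; exact hl
      rw [Matrix.submatrix_apply, Matrix.transpose_apply]
      have four : (Equiv.swap p 3) k = 0 ∨ (Equiv.swap p 3) k = 1 ∨ (Equiv.swap p 3) k = 2 ∨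
          (Equiv.swap p 3) k = 3 := by
        have : ∀ j : Fin 4, j = 0 ∨ j = 1 ∨ j = 2 ∨ j = 3 := by decide
        exact this _
      rcases four with h | h | h | h <;> rw [h]
      · exact m0' _ hlp
      · exact m1' _ hlp
      · exact f2 _
      · exact f3 _
    by_cases hgs : p = 1 ∧ p' = 0
    · -- THE GENERALISED SWAP: output
      obtain ⟨rfl, rfl⟩ := hgs
      refine ⟨σ 0, σ 1, Φ 0 1, Φ 1 0, fun h => by simpa using σ.injective h, hp', hp, ?_⟩
      intro a x
      rw [dotProduct_mulVec_submatrix Ψ σ a x, ← hΦ, hf]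
      simp only [Function.comp_apply]
      ring
    · exact absurd (frames_of_single_entries Φ p p' (Φ p 0) (Φ p' 1) hp hp' hpp hgs hf) n₁
  · -- R2: zero column `σ3`, swap pair `(σ0, σ1)`, third column `σ2`
    have n₁ := not_frames_submatrix σ Ψ h₁
    have n₂ := not_frames_transpose_submatrix σ Ψ h₂
    obtain ⟨Φ, hΦ⟩ : ∃ Φ : Matrix (Fin 4) (Fin 4) K, Φ = Ψ.submatrix σ σ := ⟨_, rfl⟩
    rw [← hΦ] at n₁ n₂
    have eΦ : ∀ i j, Φ i j = Ψ (σ i) (σ j) := fun i j => by rw [hΦ]; rfl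
    have f3 : ∀ i, Φ i 3 = 0 := fun i => by rw [eΦ]; exact h3 (σ i)
    have hla : Φ 1 0 ≠ 0 := by rw [eΦ]; exact h10
    have e01 : Φ 0 1 = Φ 1 0 := by rw [eΦ, eΦ]; exact hsym.symm
    have e00 : Φ 0 0 = 0 := by rw [eΦ]; exact hc0 _ (fun h => by simpa using σ.injective h)
    have e20 : Φ 2 0 = 0 := by rw [eΦ]; exact hc0 _ (fun h => by simpa using σ.injective h)
    have e30 : Φ 3 0 = 0 := by rw [eΦ]; exact hc0 _ (fun h => by simpa using σ.injective h)
    have e11 : Φ 1 1 = 0 := by rw [eΦ]; exact hc1 _ (fun h => by simpa using σ.injective h)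
    have e21 : Φ 2 1 = 0 := by rw [eΦ]; exact hc1 _ (fun h => by simpa using σ.injective h)
    have e31 : Φ 3 1 = 0 := by rw [eΦ]; exact hc1 _ (fun h => by simpa using σ.injective h)
    have t0 : (Equiv.swap (2 : Fin 4) 3) 0 = 0 := by decide
    have t1 : (Equiv.swap (2 : Fin 4) 3) 1 = 1 := by decide
    have t2 : (Equiv.swap (2 : Fin 4) 3) 2 = 3 := by decide
    by_cases hA : Φ 0 2 ≠ 0 ∨ Φ 1 2 ≠ 0
    · by_cases hB : Φ 2 2 ≠ 0 ∨ Φ 3 2 ≠ 0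
      · -- Case A for the transpose
        by_cases h32 : Φ 3 2 ≠ 0
        · -- columns `0, 1, 3` of `Φᵀ` (rows of `Φ`), excluded index `2`
          by_cases h02 : Φ 0 2 ≠ 0
          · obtain ⟨hcA, hnsA⟩ := caseA_of_witness Φᵀ (Equiv.swap (2 : Fin 4) 3) 2 0 2
              (by rw [t0, Matrix.transpose_apply]; exact h02)
              (by rw [t1, Matrix.transpose_apply]; exact hla)
              (by rw [t2, Matrix.transpose_apply]; exact h32)
              (Or.inl (by rw [t1]; decide)) (Or.inl (by rw [t2]; decide))
              (Or.inl (by rw [t2]; decide))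
            exact absurd (hframes_of_caseA_class Φᵀ _ hcA hnsA) n₂
          · have h12 : Φ 1 2 ≠ 0 := hA.resolve_left h02
            obtain ⟨hcA, hnsA⟩ := caseA_of_witness Φᵀ (Equiv.swap (2 : Fin 4) 3) 1 2 2
              (by rw [t0, Matrix.transpose_apply, e01]; exact hla)
              (by rw [t1, Matrix.transpose_apply]; exact h12)
              (by rw [t2, Matrix.transpose_apply]; exact h32)
              (Or.inr (by rw [t0]; decide)) (Or.inl (by rw [t2]; decide))
              (Or.inl (by rw [t2]; decide))
            exact absurd (hframes_of_caseA_class Φᵀ _ hcA hnsA) n₂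
        · have h22 : Φ 2 2 ≠ 0 := hB.resolve_right h32
          -- columns `0, 1, 2` of `Φᵀ`, excluded index `3`
          by_cases h02 : Φ 0 2 ≠ 0
          · obtain ⟨hcA, hnsA⟩ := caseA_of_witness Φᵀ 1 2 0 2
              (by rw [Equiv.Perm.coe_one, id_eq, Matrix.transpose_apply]; exact h02)
              (by rw [Equiv.Perm.coe_one, id_eq, Matrix.transpose_apply]; exact hla)
              (by rw [Equiv.Perm.coe_one, id_eq, Matrix.transpose_apply]; exact h22)
              (Or.inl (by decide)) (Or.inr (by decide)) (Or.inl (by decide))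
            exact absurd (hframes_of_caseA_class Φᵀ _ hcA hnsA) n₂
          · have h12 : Φ 1 2 ≠ 0 := hA.resolve_left h02
            obtain ⟨hcA, hnsA⟩ := caseA_of_witness Φᵀ 1 1 2 2
              (by rw [Equiv.Perm.coe_one, id_eq, Matrix.transpose_apply, e01]; exact hla)
              (by rw [Equiv.Perm.coe_one, id_eq, Matrix.transpose_apply]; exact h12)
              (by rw [Equiv.Perm.coe_one, id_eq, Matrix.transpose_apply]; exact h22)
              (Or.inr (by decide)) (Or.inl (by decide)) (Or.inr (by decide))
            exact absurd (hframes_of_caseA_class Φᵀ _ hcA hnsA) n₂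
      · -- `c₂ = c₃ = 0`: rank-one third column on the swap rows
        push Not at hB
        obtain ⟨e22, e32⟩ := hB
        refine absurd (frames_of_swap_plus_rank_one Φ (Φ 1 0) (Φ 0 2) (Φ 1 2) hla hA ?_) n₁
        ext i j
        fin_cases i <;> fin_cases j <;> simp [e00, e01, e20, e30, e11, e21, e31, e22, e32, f3]
    · -- `c₀ = c₁ = 0`
      push Not at hA
      obtain ⟨e02, e12⟩ := hA
      by_cases h22 : Φ 2 2 ≠ 0
      · by_cases h32 : Φ 3 2 ≠ 0
        · -- Case A for the transpose: columns `1, 2, 3` of `Φᵀ`, excluded index `0`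
          have r0 : (finRotate 4) 0 = 1 := by decide
          have r1 : (finRotate 4) 1 = 2 := by decide
          have r2 : (finRotate 4) 2 = 3 := by decide
          obtain ⟨hcA, hnsA⟩ := caseA_of_witness Φᵀ (finRotate 4) 0 2 2
            (by rw [r0, Matrix.transpose_apply]; exact hla)
            (by rw [r1, Matrix.transpose_apply]; exact h22)
            (by rw [r2, Matrix.transpose_apply]; exact h32)
            (Or.inl (by rw [r1]; decide)) (Or.inl (by rw [r2]; decide))
            (Or.inl (by rw [r2]; decide))
          exact absurd (hframes_of_caseA_class Φᵀ _ hcA hnsA) n₂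
        · -- `Ψ^σ = λS₀₁ + c₂E₂₂`
          push Not at h32
          refine absurd (frames_of_swap_plus_diag Φ (Φ 1 0) (Φ 2 2) hla h22 ?_) n₁
          ext i j
          fin_cases i <;> fin_cases j <;> simp [e00, e01, e20, e30, e11, e21, e31, e02, e12, h32, f3]
      · push Not at h22
        by_cases h32 : Φ 3 2 ≠ 0
        · -- `Ψ^σ = λS₀₁ + c₃E₃₂`
          refine absurd (frames_of_swap_plus_offdiag Φ (Φ 1 0) (Φ 3 2) hla h32 ?_) n₁
          ext i j
          fin_cases i <;> fin_cases j <;> simp [e00, e01, e20, e30, e11, e21, e31, e02, e12, h22, f3]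
        · -- the third column would vanish
          push Not at h32
          obtain ⟨i, hi⟩ := h2
          have four : σ.symm i = 0 ∨ σ.symm i = 1 ∨ σ.symm i = 2 ∨ σ.symm i = 3 := by
            have : ∀ j : Fin 4, j = 0 ∨ j = 1 ∨ j = 2 ∨ j = 3 := by decide
            exact this _
          have key : Φ (σ.symm i) 2 = Ψ i (σ 2) := by rw [eΦ, Equiv.apply_symm_apply]
          rcases four with h | h | h | h <;> rw [h] at key
          · exact (hi (key ▸ e02)).elim
          · exact (hi (key ▸ e12)).elim
          · exact (hi (key ▸ h22)).elim
          · exact (hi (key ▸ h32)).elim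
  · -- R3: double swap
    exact absurd (frames_of_submatrix σ Ψ (frames_of_double_swap _ la mu hla hmu hlit)) h₁

end Summit.ValiantsHypothesis.ValiantsHypothesis.Theorems.SymPencilPerFourPeeledTwoPencilCoverage

end
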